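import Literature.Analysis.FluidPDE.GaussianVortexCellProblem
import Literature.Analysis.FluidPDE.BiotSavart2DAngularModes
import Literature.Analysis.FluidPDE.GaussianVortexKernelRadial
import HarnessLib

/-!
# Maekawa's kernel lemma for classical kernel elements: proof

Discharge of the named fact `Literature.Analysis.FluidPDE.GallayMaekawa2016_lem27_classical`
(Gallay–Maekawa 2016, Lemma 2.7 = Maekawa 2011, the classical corollary of
`ker Λ = X₀ ⊕ span{∂₁G, ∂₂G}`): a `C¹` function `w ∈ L²(G⁻¹dx)` whose Biot–Savart integrals
converge absolutely and which satisfies `Λw = v^G·∇w + (K∗w)·∇G = 0` pointwise is a radial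
function plus `(β₁x₁ + β₂x₂)G`.

## The proof (angular Fourier modes; `PlanarPolarCoords`, `BiotSavart2DAngularModes`,
## `GaussianVortexKernelRadial`)

Since `v^G = Ω ξ^⊥` with `Ω = (8π)⁻¹φ(|ξ|²/4)` and `∇G = −(G/2)ξ`, the equation says
`∂_θ w(ξ) = Dw(ξ)[ξ^⊥] = Φ(|ξ|) ξ·(K∗w)(ξ)` with `Φ = G/(2Ω) = kerWeight`
(`fderiv_perp_eq_kerWeight_mul_inner`). Take the `n`-th angular Fourier coefficient on the circle
`|ξ| = r`, `n ≥ 1`: the left side gives `i n ŵ_n(r)` (integration by parts,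
`angCoeff_fderiv_perp`), the right side `Φ(r) · (i/2) ∫_0^∞ ρ (min/max)^n ŵ_n(ρ) dρ` (the multipole
expansion of the Biot–Savart kernel, `angCoeff_inner_biotSavart2D`), i.e. the radial integral
equation `ŵ_n(r) = (Φ(r)/(2n)) ∫_0^∞ ρ t^n ŵ_n(ρ) dρ` with `∫ ρ|ŵ_n| ≤ ‖w‖₁/(2π) < ∞`
(`w ∈ L¹` because `|w| ≤ ½(G⁻¹w² + G)`). By `radialMode_eq_zero` all modes `|n| ≥ 2` vanish
(`ŵ_{-n} = conj ŵ_n` for real `w`), and by `radialMode_one_eq_smul`, `ŵ_1(r) = c r e^{-r²/4}`.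
Fourier synthesis on each circle (`eq_angCoeff_sum_of_vanishing`) then gives
`w(ξ) = Re ŵ_0(|ξ|) + 2 Re(c e^{iθ}) r e^{-r²/4} = Re ŵ_0(|ξ|) + (β₁ξ₀ + β₂ξ₁)G(ξ)` with
`β₁ = 8π Re c`, `β₂ = −8π Im c`, and `w₀ = w − (β·ξ)G = Re ŵ_0(|·|)` is radial.

## References

* Th. Gallay, Y. Maekawa, *Existence and stability of viscous vortices*, arXiv:1610.08384, §2.2,
  Lemma 2.7 (PDF p. 9): `ker(Λ) = X₀ ⊕ {β₁∂₁G + β₂∂₂G}`, citing [M3] = Y. Maekawa, *Spectral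
  properties of the linearization at the Burgers vortex in the high rotation limit*, J. Math.
  Fluid Mech. 13 (2011) 515–532. [GallayMaekawa2016]
-/

noncomputable section

open Set Function Filter MeasureTheory WithLp Complex Metric
open scoped Real Topology InnerProductSpace RealInnerProductSpace ComplexConjugate

namespace Literature.Analysis.FluidPDE

/-- Local notation for the plane `ℝ² = EuclideanSpace ℝ (Fin 2)`. -/
local notation "ℝ²" => EuclideanSpace ℝ (Fin 2)

/-! ### Preliminaries -/

/-- A radial factor comes out of the angular coefficients:
`(φ(|·|) g)^_n(r) = φ(|r|) ĝ_n(r)`. [folklore] -/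
theorem angCoeff_radial_mul (φ : ℝ → ℂ) (g : ℝ² → ℂ) (r : ℝ) (n : ℤ) :
    angCoeff (fun ξ => φ ‖ξ‖ * g ξ) r n = φ |r| * angCoeff g r n := by
  simp only [angCoeff, norm_circlePt]
  rw [mul_left_comm (φ |r|), ← intervalIntegral.integral_const_mul (φ |r|)]
  congr 1
  refine intervalIntegral.integral_congr fun θ _ => ?_
  ring

/-- `∇G(ξ) = −(G(ξ)/2) ξ` (vector form of `fderiv_gaussVortexProfile_apply`). [folklore] -/
theorem gradient_gaussVortexProfile_eq_smul (ξ : ℝ²) :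
    gradient gaussVortexProfile ξ = -(gaussVortexProfile ξ / 2) • ξ := by
  refine ext_inner_right ℝ fun v => ?_
  rw [gradient, InnerProductSpace.toDual_symm_apply, fderiv_gaussVortexProfile_apply,
    real_inner_smul_left]

/-- **`L²(G⁻¹dx) ⊂ L¹`**: a continuous `w` with `∫ G⁻¹w² < ∞` is integrable, since
`|w| ≤ ½(G⁻¹w² + G)` (`= ½G⁻¹(|w| − G)² ≥ 0` away) and `∫ G = 1`. [folklore] -/
theorem integrable_of_gaussWeighted_sq {w : ℝ² → ℝ} (hwc : Continuous w)
    (hX : Integrable (fun ξ => (gaussVortexProfile ξ)⁻¹ * w ξ ^ 2)) : Integrable w := by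
  refine Integrable.mono' ((hX.add integrable_gaussVortexProfile).div_const 2)
    hwc.aestronglyMeasurable (Eventually.of_forall fun ξ => ?_)
  change ‖w ξ‖ ≤ ((gaussVortexProfile ξ)⁻¹ * w ξ ^ 2 + gaussVortexProfile ξ) / 2
  rw [Real.norm_eq_abs]
  have hG := gaussVortexProfile_pos ξ
  have h0 : 0 ≤ (gaussVortexProfile ξ)⁻¹ * (|w ξ| - gaussVortexProfile ξ) ^ 2 := by positivity
  have key : (gaussVortexProfile ξ)⁻¹ * w ξ ^ 2 + gaussVortexProfile ξ - 2 * |w ξ| =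
      (gaussVortexProfile ξ)⁻¹ * (|w ξ| - gaussVortexProfile ξ) ^ 2 := by
    rw [sub_sq, sq_abs]
    field_simp
    ring
  rw [le_div_iff₀ two_pos]
  linarith

/-- `⟪∇f(x), v⟫ = Df(x) v` over `ℝ` (private copy of `BiotSavartCurlPair.inner_gradient_left`,
kept local to avoid the import). [folklore] -/
private theorem inner_gradient_left' (f : ℝ² → ℝ) (x v : ℝ²) :
    ⟪gradient f x, v⟫ = fderiv ℝ f x v := by
  rw [gradient, InnerProductSpace.toDual_symm_apply]

/-- **The kernel equation as an angular derivative.** If `Λw = 0` pointwise, i.e.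
`⟪v^G(ξ), ∇w(ξ)⟫ + ⟪(K∗w)(ξ), ∇G(ξ)⟫ = 0`, then `Dw(ξ)[ξ^⊥] = Φ(|ξ|) ⟪(K∗w)(ξ), ξ⟫` with
`Φ = 4πG/φ = kerWeight` (`v^G = (8π)⁻¹φ ξ^⊥`, `∇G = −(G/2)ξ`). [folklore] -/
theorem fderiv_perp_eq_kerWeight_mul_inner {w : ℝ² → ℝ}
    (hΛ : ∀ ξ, ⟪gaussVortexVelocity ξ, gradient w ξ⟫ +
      ⟪biotSavart2D w ξ, gradient gaussVortexProfile ξ⟫ = 0) (ξ : ℝ²) :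
    fderiv ℝ w ξ (perp ξ) = kerWeight ‖ξ‖ * ⟪biotSavart2D w ξ, ξ⟫ := by
  have h := hΛ ξ
  rw [gaussVortexVelocity, real_inner_smul_left, real_inner_comm (gradient w ξ) (perp ξ),
    inner_gradient_left', gradient_gaussVortexProfile_eq_smul, real_inner_smul_right] at h
  rw [kerWeight_norm_eq]
  have hφ : burgersPhi (‖ξ‖ ^ 2 / 4) ≠ 0 := (burgersPhi_pos _).ne'
  have hπ : (π : ℝ) ≠ 0 := Real.pi_pos.ne'
  field_simp
  field_simp at h
  linear_combination (1 / 2 : ℝ) * h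

/-! ### The radial mode equations of a classical kernel element -/

/-- **The mode equations.** For a classical kernel element `w` (continuous derivative,
`w ∈ L¹`, absolutely convergent Biot–Savart integrals, `Λw = 0` pointwise) the angular Fourier
coefficients `ŵ_n(r) = angCoeff w r n`, `n ≥ 1`, satisfy
`ŵ_n(r) = (Φ(r)/(2n)) ∫_0^∞ ρ (min(r,ρ)/max(r,ρ))^n ŵ_n(ρ) dρ` for `r > 0`. [folklore] -/
theorem angCoeff_eq_kerWeight_mul_integral {w : ℝ² → ℝ} (hw : ContDiff ℝ 1 w)
    (hwi : Integrable w) (hK : ∀ ξ, Integrable (fun η => w η • biotSavartKernel2D (ξ - η)))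
    (hΛ : ∀ ξ, ⟪gaussVortexVelocity ξ, gradient w ξ⟫ +
      ⟪biotSavart2D w ξ, gradient gaussVortexProfile ξ⟫ = 0)
    {n : ℕ} (hn : 1 ≤ n) {r : ℝ} (hr : 0 < r) :
    angCoeff (fun ξ => (w ξ : ℂ)) r n = ((kerWeight r / (2 * n) : ℝ) : ℂ) *
      ∫ ρ in Ioi (0 : ℝ), ((ρ * (min r ρ / max r ρ) ^ n : ℝ) : ℂ) *
        angCoeff (fun ξ => (w ξ : ℂ)) ρ n := by
  have hwc : Continuous w := hw.continuous
  have h1 : angCoeff (fun ξ => (fderiv ℝ w ξ (perp ξ) : ℂ)) r n =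
      I * n * angCoeff (fun ξ => (w ξ : ℂ)) r n := by
    have := angCoeff_fderiv_perp hw r n
    simpa using this
  have h2 : angCoeff (fun ξ => (fderiv ℝ w ξ (perp ξ) : ℂ)) r n =
      angCoeff (fun ξ => ((kerWeight ‖ξ‖ : ℝ) : ℂ) * (⟪biotSavart2D w ξ, ξ⟫ : ℂ)) r n := by
    congr 1
    funext ξ
    rw [fderiv_perp_eq_kerWeight_mul_inner hΛ ξ]
    push_cast
    ring
  have h3 : angCoeff (fun ξ => ((kerWeight ‖ξ‖ : ℝ) : ℂ) * (⟪biotSavart2D w ξ, ξ⟫ : ℂ)) r n =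
      (kerWeight r : ℂ) * angCoeff (fun ξ => (⟪biotSavart2D w ξ, ξ⟫ : ℂ)) r n := by
    rw [angCoeff_radial_mul (fun s => ((kerWeight s : ℝ) : ℂ)), abs_of_pos hr]
  have h4 := angCoeff_inner_biotSavart2D hwc hwi hK hr hn
  have key : I * n * angCoeff (fun ξ => (w ξ : ℂ)) r n =
      (kerWeight r : ℂ) * (I / 2 * ∫ ρ in Ioi (0 : ℝ), ((ρ * (min r ρ / max r ρ) ^ n : ℝ) : ℂ) *
        angCoeff (fun ξ => (w ξ : ℂ)) ρ n) := by
    rw [← h1, h2, h3, h4]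
  have hIn : (I * n : ℂ) ≠ 0 := mul_ne_zero Complex.I_ne_zero (by exact_mod_cast (by omega : n ≠ 0))
  apply mul_left_cancel₀ hIn
  rw [key]
  have hn0 : (n : ℂ) ≠ 0 := by exact_mod_cast (by omega : n ≠ 0)
  push_cast
  field_simp

/-! ### The theorem -/

/-- **Gallay–Maekawa 2016, Lemma 2.7 (Maekawa 2011), classical form — PROVED.** A `C¹`
function `w ∈ L²(G⁻¹dx)` on `ℝ²` whose Biot–Savart integrals converge absolutely and which
satisfies `Λw = ⟪v^G, ∇w⟫ + ⟪K∗w, ∇G⟫ = 0` pointwise is a radial function plus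
`(β₁x₁ + β₂x₂)G`: all angular Fourier modes `|n| ≥ 2` vanish and the modes `±1` are those of
`(β₁x₁ + β₂x₂)G` (see the module docstring for the proof). [cite: GallayMaekawa2016, Lemma 2.7] -/
theorem GallayMaekawa2016_lem27_classical_holds : GallayMaekawa2016_lem27_classical := by
  intro w hw hX hK hΛ
  -- regularity
  have hwc : Continuous w := hw.continuous
  have hwi : Integrable w := integrable_of_gaussWeighted_sq hwc hX
  set W : ℝ² → ℂ := fun ξ => (w ξ : ℂ) with hW
  have hWc : Continuous W := Complex.continuous_ofReal.comp hwc
  have hWi : Integrable W := hwi.ofReal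
  -- the mode equations and their solution
  have hmode := fun (n : ℕ) (hn : 1 ≤ n) (r : ℝ) (hr : 0 < r) =>
    angCoeff_eq_kerWeight_mul_integral hw hwi hK hΛ hn hr
  have hge2 : ∀ n : ℕ, 2 ≤ n → ∀ r, 0 < r → angCoeff W r n = 0 := fun n hn =>
    radialMode_eq_zero hn (continuous_angCoeff hWc n) (integrableOn_mul_norm_angCoeff hWc hWi n)
      (hmode n (by omega))
  obtain ⟨c, hc⟩ : ∃ c : ℂ, ∀ r, 0 < r →
      angCoeff W r 1 = c * ((r * Real.exp (-(r ^ 2 / 4)) : ℝ) : ℂ) :=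
    radialMode_one_eq_smul (continuous_angCoeff hWc 1) (integrableOn_mul_norm_angCoeff hWc hWi 1)
      (fun r hr => by simpa using hmode 1 le_rfl r hr)
  -- all integer modes `|n| ≥ 2` vanish on every circle `r ≥ 0`, and mode `1` is `c r e^{-r²/4}`
  have hvan : ∀ r, 0 ≤ r → ∀ n : ℤ, 2 ≤ |n| → angCoeff W r n = 0 := by
    intro r hr n hn
    rcases hr.eq_or_lt with h0 | hpos
    · rw [← h0]
      exact angCoeff_zero_radius W (by intro h; rw [h] at hn; simp at hn)
    · rcases le_or_gt 0 n with hn0 | hn0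
      · rw [abs_of_nonneg hn0] at hn
        have h := hge2 n.toNat (by omega) r hpos
        rwa [show ((n.toNat : ℕ) : ℤ) = n from Int.toNat_of_nonneg hn0] at h
      · rw [abs_of_neg hn0] at hn
        have h := hge2 (-n).toNat (by omega) r hpos
        rw [show (((-n).toNat : ℕ) : ℤ) = -n from Int.toNat_of_nonneg (by omega)] at h
        rw [show n = -(-n) by ring, angCoeff_neg_ofReal, h, map_zero]
  have hone : ∀ r, 0 ≤ r → angCoeff W r 1 = c * ((r * Real.exp (-(r ^ 2 / 4)) : ℝ) : ℂ) := by
    intro r hr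
    rcases hr.eq_or_lt with h0 | hpos
    · rw [← h0, angCoeff_zero_radius W one_ne_zero]; simp
    · exact hc r hpos
  -- the decomposition
  refine ⟨8 * π * c.re, -(8 * π * c.im),
    fun ξ => w ξ - (8 * π * c.re * ξ 0 + -(8 * π * c.im) * ξ 1) * gaussVortexProfile ξ, ?_,
    fun ξ => by ring⟩
  -- radiality: `w − (β·ξ)G = Re ŵ₀(|ξ|)`
  suffices hrad : ∀ ξ : ℝ², w ξ - (8 * π * c.re * ξ 0 + -(8 * π * c.im) * ξ 1) * gaussVortexProfile ξ =
      (angCoeff W ‖ξ‖ 0).re by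
    intro ξ η hξη
    beta_reduce
    rw [hrad ξ, hrad η, hξη]
  intro ξ
  set r : ℝ := ‖ξ‖ with hr
  set θ : ℝ := Complex.arg (cplx ξ) with hθ
  have hξ : circlePt r θ = ξ := circlePt_norm_arg ξ
  have hs := eq_angCoeff_sum_of_vanishing hWc r (hvan r (norm_nonneg ξ)) θ
  rw [hξ, angCoeff_neg_ofReal w r 1] at hs
  change W ξ = angCoeff W r 0 + angCoeff W r 1 * angExp 1 θ +
    conj (angCoeff W r 1) * angExp (-1) θ at hs
  rw [hone r (norm_nonneg ξ)] at hs
  have hre := congrArg Complex.re hs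
  simp only [hW, Complex.ofReal_re, Complex.add_re, Complex.mul_re, Complex.mul_im,
    Complex.ofReal_im, Complex.conj_re, Complex.conj_im, angExp_re, angExp_im, map_mul,
    Complex.conj_ofReal, Int.cast_one, Int.cast_neg, one_mul, neg_mul, Real.cos_neg,
    Real.sin_neg, mul_zero, sub_zero] at hre
  have hξ0 : ξ 0 = r * Real.cos θ := by rw [← hξ]; rfl
  have hξ1 : ξ 1 = r * Real.sin θ := by rw [← hξ]; rfl
  have hG : gaussVortexProfile ξ = (4 * π)⁻¹ * Real.exp (-(r ^ 2 / 4)) := by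
    rw [gaussVortexProfile, hr]
  rw [hre, hξ0, hξ1, hG]
  have hπ : (π : ℝ) ≠ 0 := Real.pi_pos.ne'
  field_simp
  ring

end Literature.Analysis.FluidPDE
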